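import Literature.Algebra.Homology.HeisenbergObstructionCocycle
import HarnessLib

/-!
# The obstruction `2`-cocycle of a crossed homomorphism, II: quadraticity, coboundaries, gauge, pull-back

Sequel of `HeisenbergObstructionCocycle.lean` (same conventions; `D : HeisenbergDatum G M A`, the group
`V = D.Ext`, `conn ξ (σ,τ) = χ_σ(ξ_τ) + m(ξ_σ, σξ_τ)`).  PROVED here:

* `conn_coboundary` — changing `ξ` by a principal crossed homomorphism `σ ↦ σx − x` changes `conn ξ` by
  an explicit coboundary (conjugate the lifts by `s(x)`);
* `conn_add` — QUADRATICITY (Zarhin 1974 §2; Poonen–Rains 2012 Cor. 4.6):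
  `conn (ξ+η) = conn ξ + conn η + e(η_σ, σξ_τ) − ∂b`, `b(σ) = m(ξ_σ, η_σ)`: up to a coboundary the polar
  form of `ξ ↦ [conn ξ]` is the cup product `(η ∪_e ξ)(σ,τ) = e(η_σ, σ ξ_τ)` for the commutator pairing
  `e` (the tree's `ContPairing.cupCocycle` convention `(σ,τ) ↦ ⟨f σ, σ g τ⟩`);
* `gauge` / `conn_gauge` / `commForm_gauge` — changing the section by `λ : M → A` (`λ 0 = 0`) gives the
  datum `(m + ∂λ, χ_σ + σλ − λσ)`, changes `conn ξ` by the coboundary of `λ ∘ ξ` and keeps `e`;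
* `comap`, `conn_comap`, `conn_comp`, `isCrossedHom_comp` — pull-back along `φ : H →* G`.

Coboundaries are written in the convention of the tree's `twoCocycleClass_eq_zero_iff`
(`f(σ,τ) = σ b(τ) − b(στ) + b(σ)`).  References: Brown, *Cohomology of Groups* IV §3; Serre, *Galois
Cohomology* I §5.1, §5.7 [SerreGaloisCohomology1997]; Zarhin, Mat. Zametki 15 (1974) §2; Poonen–Rains,
JAMS 25 (2012) Cor. 4.6 [PoonenRains2012].  Elementary algebra, complete proofs, no named fact.
-/

set_option autoImplicit false

namespace Literature.Algebra.Homology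

namespace HeisenbergDatum

universe u v w

variable {G : Type u} {M : Type v} {A : Type w} [Monoid G] [AddCommGroup M] [AddCommGroup A]
variable (D : HeisenbergDatum G M A)

/-- **Change of `ξ` by a principal crossed homomorphism.**  For `x ∈ M` and
`ξ'(σ) = ξ(σ) + (σx − x)`: `conn ξ' = conn ξ − ∂b` with the explicit `1`-cochain
`b(σ) = χ_σ(x) + m(ξ_σ, σx) − m(x, ξ'_σ)`, in the tree's coboundary convention
`(∂b)(σ,τ) = σ b(τ) − b(στ) + b(σ)`.  (Conjugate the lifts by `s(x)`.) Serre, I §5.1 and §5.7. [cite: SerreGaloisCohomology1997, I §5.7 (connecting map of a central extension of G-groups)] -/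
theorem conn_coboundary {ξ : G → M} (hξ : D.IsCrossedHom ξ) (x : M) (g h : G) :
    D.conn (fun σ => ξ σ + (D.ρ σ x - x)) g h =
      D.conn ξ g h - (D.α g (D.χ h x + D.m (ξ h) (D.ρ h x) - D.m x (ξ h + (D.ρ h x - x)))
        - (D.χ (g * h) x + D.m (ξ (g * h)) (D.ρ (g * h) x) - D.m x (ξ (g * h) + (D.ρ (g * h) x - x)))
        + (D.χ g x + D.m (ξ g) (D.ρ g x) - D.m x (ξ g + (D.ρ g x - x)))) := by
  set ξ' : G → M := fun σ => ξ σ + (D.ρ σ x - x) with hξ'def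
  set b : G → A := fun σ => D.χ σ x + D.m (ξ σ) (D.ρ σ x) - D.m x (ξ' σ) with hbdef
  have hξ' : D.IsCrossedHom ξ' := fun σ τ => by
    have := hξ.add (D.isCrossedHom_principal x) σ τ
    simpa only [hξ'def, Pi.add_apply] using this
  -- the conjugated lifts `z σ := inl (b σ) * sec (ξ' σ)` satisfy `sec x * z σ = sec (ξ σ) * σ(sec x)`
  set z : G → D.Ext := fun σ => D.inl (b σ) * D.sec (ξ' σ) with hzdef
  have hA : ∀ σ, D.sec x * z σ = D.sec (ξ σ) * D.act σ (D.sec x) := by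
    intro σ
    ext
    · simp only [hzdef, hbdef, hξ'def, Ext.mul_a, Ext.mul_x, sec_a, sec_x, inl_a, inl_x, act_apply_a,
        act_apply_x, D.m_zero_left, map_zero, zero_add, add_zero]
      abel
    · simp only [hzdef, hξ'def, Ext.mul_x, sec_x, inl_x, act_apply_x, zero_add]
      abel
  -- hence `z` satisfies the same multiplication rule as the lifts of `ξ`
  have hB : ∀ σ τ, z σ * D.act σ (z τ) = D.inl (D.conn ξ σ τ) * z (σ * τ) := by
    intro σ τ
    apply mul_left_cancel (a := D.sec x)
    calc D.sec x * (z σ * D.act σ (z τ))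
        = (D.sec x * z σ) * D.act σ (z τ) := by group
      _ = D.sec (ξ σ) * (D.act σ (D.sec x) * D.act σ (z τ)) := by rw [hA σ, mul_assoc]
      _ = D.sec (ξ σ) * D.act σ (D.sec (ξ τ) * D.act τ (D.sec x)) := by rw [← map_mul, hA τ]
      _ = (D.sec (ξ σ) * D.act σ (D.sec (ξ τ))) * D.act (σ * τ) (D.sec x) := by
          rw [map_mul, act_mul, mul_assoc]
      _ = D.inl (D.conn ξ σ τ) * (D.sec x * z (σ * τ)) := by
          rw [sec_mul_act_sec D hξ σ τ, mul_assoc, ← hA (σ * τ)]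
      _ = D.sec x * (D.inl (D.conn ξ σ τ) * z (σ * τ)) := by
          rw [← mul_assoc, inl_mul_comm, mul_assoc]
  -- read off the `A`-coordinates
  have hC : ∀ σ τ, z σ * D.act σ (z τ) = D.inl (b σ + D.α σ (b τ) + D.conn ξ' σ τ) * D.sec (ξ' (σ * τ)) := by
    intro σ τ
    simp only [hzdef]
    rw [map_mul, act_inl, mul_assoc, ← mul_assoc (D.sec (ξ' σ)), ← inl_mul_comm, mul_assoc,
      sec_mul_act_sec D hξ' σ τ, ← mul_assoc, ← mul_assoc, ← inl_add, ← inl_add]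
  have key : ∀ σ τ, b σ + D.α σ (b τ) + D.conn ξ' σ τ = D.conn ξ σ τ + b (σ * τ) := by
    intro σ τ
    have e := (hC σ τ).symm.trans (hB σ τ)
    simp only [hzdef] at e
    rw [← mul_assoc, ← inl_add] at e
    exact D.inl_injective (mul_right_cancel e)
  have hfin : D.conn ξ' g h = D.conn ξ g h - (D.α g (b h) - b (g * h) + b g) := by
    linear_combination (norm := abel) key g h
  simpa only [hbdef, hξ'def] using hfin

/-- **Quadraticity (Zarhin; Poonen–Rains 2012 Cor. 4.6).**  For crossed homomorphisms `ξ, η`: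
`conn (ξ+η)(σ,τ) = conn ξ (σ,τ) + conn η (σ,τ) + e(η_σ, σ ξ_τ) − (σ b(τ) − b(στ) + b(σ))` with
`b(σ) = m(ξ_σ, η_σ)`: up to the coboundary `∂b`, the polar form of `ξ ↦ conn ξ` is the cup product
`(η ∪_e ξ)(σ,τ) = e(η_σ, σξ_τ)` for the commutator pairing `e`.  (Use the lifts `s(ξ_σ)s(η_σ)`.) [cite: PoonenRains2012, Cor. 4.6 (the connecting map is quadratic with polar form the cup product)] -/
theorem conn_add {ξ η : G → M} (hξ : D.IsCrossedHom ξ) (hη : D.IsCrossedHom η) (g h : G) :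
    D.conn (ξ + η) g h = D.conn ξ g h + D.conn η g h + D.commForm (η g) (D.ρ g (ξ h))
      - (D.α g (D.m (ξ h) (η h)) - D.m (ξ (g * h)) (η (g * h)) + D.m (ξ g) (η g)) := by
  have hξη : D.IsCrossedHom (ξ + η) := hξ.add hη
  set b : G → A := fun σ => D.m (ξ σ) (η σ) with hbdef
  have hz : ∀ σ, D.sec (ξ σ) * D.sec (η σ) = D.inl (b σ) * D.sec ((ξ + η) σ) := fun σ => by
    rw [sec_mul_sec, Pi.add_apply]
  -- the product lifts computed through the commutation rule …
  have lhs : ∀ σ τ, (D.sec (ξ σ) * D.sec (η σ)) * D.act σ (D.sec (ξ τ) * D.sec (η τ))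
      = D.inl (D.commForm (η σ) (D.ρ σ (ξ τ)) + (D.conn ξ σ τ + D.conn η σ τ))
          * (D.sec (ξ (σ * τ)) * D.sec (η (σ * τ))) := by
    intro σ τ
    have hcomm : D.sec (η σ) * D.act σ (D.sec (ξ τ))
        = D.inl (D.commForm (η σ) (D.ρ σ (ξ τ))) * (D.act σ (D.sec (ξ τ)) * D.sec (η σ)) := by
      have := mul_eq_inl_commForm_mul D (D.sec (η σ)) (D.act σ (D.sec (ξ τ)))
      simpa only [sec_x, act_apply_x] using this
    set Xs := D.sec (ξ σ)
    set Ys := D.sec (η σ)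
    set Xt := D.act σ (D.sec (ξ τ)) with hXt
    set Yt := D.act σ (D.sec (η τ)) with hYt
    set c := D.inl (D.commForm (η σ) (D.ρ σ (ξ τ))) with hc
    calc Xs * Ys * D.act σ (D.sec (ξ τ) * D.sec (η τ))
        = Xs * (Ys * Xt) * Yt := by rw [map_mul, ← hXt, ← hYt]; group
      _ = Xs * c * (Xt * Ys * Yt) := by rw [hcomm]; group
      _ = c * ((Xs * Xt) * (Ys * Yt)) := by rw [hc, ← inl_mul_comm]; group
      _ = c * ((D.inl (D.conn ξ σ τ) * D.sec (ξ (σ * τ))) * (D.inl (D.conn η σ τ) * D.sec (η (σ * τ)))) := by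
          rw [sec_mul_act_sec D hξ σ τ, sec_mul_act_sec D hη σ τ]
      _ = c * (D.inl (D.conn ξ σ τ) * (D.sec (ξ (σ * τ)) * D.inl (D.conn η σ τ)) * D.sec (η (σ * τ))) := by
          group
      _ = c * (D.inl (D.conn ξ σ τ) * D.inl (D.conn η σ τ)) * (D.sec (ξ (σ * τ)) * D.sec (η (σ * τ))) := by
          rw [← inl_mul_comm D (D.conn η σ τ)]; group
      _ = _ := by rw [hc, ← inl_add, ← inl_add]
  -- … and through the section of `ξ + η`
  have rhs : ∀ σ τ, (D.sec (ξ σ) * D.sec (η σ)) * D.act σ (D.sec (ξ τ) * D.sec (η τ))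
      = D.inl (b σ + D.α σ (b τ) + D.conn (ξ + η) σ τ) * D.sec ((ξ + η) (σ * τ)) := by
    intro σ τ
    rw [hz σ, hz τ, map_mul, act_inl, mul_assoc, ← mul_assoc (D.sec ((ξ + η) σ)), ← inl_mul_comm,
      mul_assoc, sec_mul_act_sec D hξη σ τ, ← mul_assoc, ← mul_assoc, ← inl_add, ← inl_add]
  have key : b g + D.α g (b h) + D.conn (ξ + η) g h
      = D.commForm (η g) (D.ρ g (ξ h)) + (D.conn ξ g h + D.conn η g h) + b (g * h) := by
    have e := (rhs g h).symm.trans (lhs g h)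
    rw [hz (g * h), ← mul_assoc, ← inl_add] at e
    exact D.inl_injective (mul_right_cancel e)
  linear_combination (norm := abel) key

/-! ### Change of section (gauge) and pull-back -/

/-- **Change of section.**  Replacing `s(x) = (0,x)` by `s'(x) = (λ x, x)` (`λ 0 = 0`) describes the SAME
`G`-group `V` by the datum `m' = m + ∂λ`, `χ'_σ = χ_σ + σλ − λσ`. Brown IV §3 (cohomologous cocycles). [cite: Brown1982, Ch. IV §3 (extensions defined by a 2-cocycle)] -/
def gauge (lam : M → A) (hlam : lam 0 = 0) : HeisenbergDatum G M A where
  ρ := D.ρ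
  α := D.α
  m x y := D.m x y + lam x + lam y - lam (x + y)
  χ g x := D.χ g x + D.α g (lam x) - lam (D.ρ g x)
  m_zero_left y := by simp [D.m_zero_left, hlam]
  m_zero_right x := by simp [D.m_zero_right, hlam]
  m_cocycle x y z := by
    rw [add_assoc x y z]
    linear_combination (norm := abel) D.m_cocycle x y z
  smul_m g x y := by
    simp only [map_add, map_sub]
    linear_combination (norm := abel) D.smul_m g x y
  χ_mul g h x := by
    simp only [D.χ_mul, map_mul, AddMonoid.End.coe_mul, Function.comp_apply, map_add, map_sub]
    abel

/-- The actions of the gauged datum are unchanged (`ρ`). [cite: Brown1982, Ch. IV §3 (extensions defined by a 2-cocycle)] -/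
@[simp] theorem gauge_ρ (lam : M → A) (hlam : lam 0 = 0) : (D.gauge lam hlam).ρ = D.ρ := rfl
/-- The actions of the gauged datum are unchanged (`α`). [cite: Brown1982, Ch. IV §3 (extensions defined by a 2-cocycle)] -/
@[simp] theorem gauge_α (lam : M → A) (hlam : lam 0 = 0) : (D.gauge lam hlam).α = D.α := rfl
/-- The cocycle of the gauged datum. [cite: Brown1982, Ch. IV §3 (extensions defined by a 2-cocycle)] -/
theorem gauge_m (lam : M → A) (hlam : lam 0 = 0) (x y : M) :
    (D.gauge lam hlam).m x y = D.m x y + lam x + lam y - lam (x + y) := rfl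
/-- The correction terms of the gauged datum. [cite: Brown1982, Ch. IV §3 (extensions defined by a 2-cocycle)] -/
theorem gauge_χ (lam : M → A) (hlam : lam 0 = 0) (g : G) (x : M) :
    (D.gauge lam hlam).χ g x = D.χ g x + D.α g (lam x) - lam (D.ρ g x) := rfl

/-- Crossed homomorphisms for `D` and for its gauge are the same notion. [cite: SerreGaloisCohomology1997, I §5.1 (cocycles, crossed homomorphisms)] -/
theorem isCrossedHom_gauge_iff (lam : M → A) (hlam : lam 0 = 0) (ξ : G → M) :
    (D.gauge lam hlam).IsCrossedHom ξ ↔ D.IsCrossedHom ξ := Iff.rfl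

/-- `conn` for the gauged datum differs by the coboundary of `λ ∘ ξ`:
`conn' ξ (σ,τ) = conn ξ (σ,τ) + (σ λ(ξ_τ) − λ(ξ_{στ}) + λ(ξ_σ))`. [cite: Brown1982, Ch. IV §3 (extensions defined by a 2-cocycle)] -/
theorem conn_gauge (lam : M → A) (hlam : lam 0 = 0) {ξ : G → M} (hξ : D.IsCrossedHom ξ) (g h : G) :
    (D.gauge lam hlam).conn ξ g h
      = D.conn ξ g h + (D.α g (lam (ξ h)) - lam (ξ (g * h)) + lam (ξ g)) := by
  simp only [conn, gauge_m, gauge_χ, gauge_ρ, hξ g h]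
  abel

/-- The commutator form is gauge-invariant. [cite: PoonenRains2012, Prop. 4.5 (c) (commutator pairing of the Heisenberg group)] -/
@[simp] theorem commForm_gauge (lam : M → A) (hlam : lam 0 = 0) (x y : M) :
    (D.gauge lam hlam).commForm x y = D.commForm x y := by
  simp only [commForm, gauge_m, add_comm y x]
  abel

/-- **Pull-back** of a Heisenberg datum along a monoid homomorphism `φ : H →* G` (`H` acting through `φ`).
[cite: SerreGaloisCohomology1997, I §2.4 and I §5.8 (compatible pairs, functoriality)] -/
def comap {H : Type*} [Monoid H] (φ : H →* G) : HeisenbergDatum H M A where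
  ρ := D.ρ.comp φ
  α := D.α.comp φ
  m := D.m
  χ h := D.χ (φ h)
  m_zero_left := D.m_zero_left
  m_zero_right := D.m_zero_right
  m_cocycle := D.m_cocycle
  smul_m h x y := D.smul_m (φ h) x y
  χ_mul g h x := by simp only [map_mul, MonoidHom.coe_comp, Function.comp_apply, D.χ_mul]

/-- The `M`-action of the pulled-back datum. [cite: SerreGaloisCohomology1997, I §2.4 and I §5.8 (compatible pairs, functoriality)] -/
@[simp] theorem comap_ρ_apply {H : Type*} [Monoid H] (φ : H →* G) (h : H) :
    (D.comap φ).ρ h = D.ρ (φ h) := rfl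
/-- The `A`-action of the pulled-back datum. [cite: SerreGaloisCohomology1997, I §2.4 and I §5.8 (compatible pairs, functoriality)] -/
@[simp] theorem comap_α_apply {H : Type*} [Monoid H] (φ : H →* G) (h : H) :
    (D.comap φ).α h = D.α (φ h) := rfl
/-- The cocycle of the pulled-back datum. [cite: SerreGaloisCohomology1997, I §2.4 and I §5.8 (compatible pairs, functoriality)] -/
@[simp] theorem comap_m {H : Type*} [Monoid H] (φ : H →* G) : (D.comap φ).m = D.m := rfl
/-- The correction terms of the pulled-back datum. [cite: SerreGaloisCohomology1997, I §2.4 and I §5.8 (compatible pairs, functoriality)] -/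
@[simp] theorem comap_χ {H : Type*} [Monoid H] (φ : H →* G) (h : H) : (D.comap φ).χ h = D.χ (φ h) := rfl

/-- `conn` of the pulled-back datum, unfolded. [cite: SerreGaloisCohomology1997, I §2.4 and I §5.8 (compatible pairs, functoriality)] -/
theorem conn_comap {H : Type*} [Monoid H] (φ : H →* G) (ξ : H → M) (g h : H) :
    (D.comap φ).conn ξ g h = D.χ (φ g) (ξ h) + D.m (ξ g) (D.ρ (φ g) (ξ h)) := rfl

/-- The commutator form of the pulled-back datum is the same. [cite: PoonenRains2012, Prop. 4.5 (c) (commutator pairing of the Heisenberg group)] -/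
@[simp] theorem commForm_comap {H : Type*} [Monoid H] (φ : H →* G) (x y : M) :
    (D.comap φ).commForm x y = D.commForm x y := rfl

/-- A crossed homomorphism of `G` pulls back to one of `H`. [cite: SerreGaloisCohomology1997, I §2.4 and I §5.8 (compatible pairs, functoriality)] -/
theorem isCrossedHom_comp {H : Type*} [Monoid H] (φ : H →* G) {ξ : G → M} (hξ : D.IsCrossedHom ξ) :
    (D.comap φ).IsCrossedHom (ξ ∘ φ) := fun g h => by
  show ξ (φ (g * h)) = ξ (φ g) + D.ρ (φ g) (ξ (φ h))
  rw [map_mul]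
  exact hξ _ _

/-- `conn` commutes with pull-back of crossed homomorphisms: `conn (ξ ∘ φ) = conn ξ ∘ (φ × φ)`. [cite: SerreGaloisCohomology1997, I §2.4 and I §5.8 (compatible pairs, functoriality)] -/
theorem conn_comp {H : Type*} [Monoid H] (φ : H →* G) (ξ : G → M) (g h : H) :
    (D.comap φ).conn (ξ ∘ φ) g h = D.conn ξ (φ g) (φ h) := rfl

end HeisenbergDatum

end Literature.Algebra.Homology
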